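import Mathlib
import Summits.ValiantsHypothesis.ValiantsHypothesis.Theorems.MonotoneRestorationOrbitRestorationQPRowColumnDichotomy
import HarnessLib

/-!
# Essential-variable dichotomy for matrix-symmetric polynomials; the sub-quadratic depth-three stratum (ORBIT currency)

Route MonotoneRestoration, crux `OrbitRestorationQP` (stmt-ValiantsHypothesis-18293), line `depth-three-rung`, registered stub
`stub_sigmaPiSigmaValue` (A_∞).  Namespace `Summit.ValiantsHypothesis.ValiantsHypothesis.Theorems.RowColumnDichotomy` (continued
from `Theorems/MonotoneRestorationOrbitRestorationQPRowColumnDichotomy.lean`, theorem `dichotomy`).  Route-independent, definition-free.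

* `exists_eq_rowcol` / `le_span_rowcol` — if all double differences of linear coefficients vanish on `W`, every `w ∈ W` is
  `c₀ + Σ_i α_i r_i + Σ_j β_j c_j` with the ROW SUMS `r_i = Σ_j x_ij` and COLUMN SUMS `c_j = Σ_i x_ij`;
* `sq_succ_le_finrank` — if `W ∋ 1` contains all double-difference forms `x_ab − x_a'b − x_ab' + x_a'b'`, then
  `(n−1)² + 1 ≤ dim W`;
* `mem_adjoin_rowcol_of_admissible` — **ESSENTIAL-VARIABLE DICHOTOMY**: a MATRIX-SYMMETRIC polynomial `p` lying in `ℂ[Λ]` for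
  some space `Λ` of affine forms containing the constants with `dim Λ ≤ (n−1)²` is a polynomial in the row sums and the column
  sums (the essential space `LinearSubalgebra.ess p` is stable under `x_pq ↦ x_{σ p, τ q}` by `ess_map`, so `dichotomy` applies
  to it, and the second alternative is excluded by dimension);
* `mem_adjoin_rowcol_of_depthThree` — **SUB-QUADRATIC DEPTH-THREE STRATUM of A_∞**: a matrix-symmetric
  `p = Σ_{i<k} C(a i) · Π (L i)` with affine factors and TOTAL PRODUCT FAN-IN `Σ_i |L i| < (n−1)²` is a polynomial in the row
  sums and the column sums.  Below `(n−1)²` wires into the product layer a depth-three representation of a matrix-symmetric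
  polynomial carries no asymmetric information: the essential variables of `p` are among the `2n` forms `r_i, c_j`; above the
  threshold, ANY generating space of affine forms for `p` contains all `(n−1)²` double-difference forms.

* `rename₂_mem_ess`, `ddiff_mem_of_not_mem_adjoin_rowcol`, `sq_succ_le_finrank_of_not_mem_adjoin_rowcol` — **RIGIDITY ABOVE THE
  THRESHOLD**: if a matrix-symmetric `p` is not in `ℂ[r, c]`, every admissible space (e.g. the span of the factors of any
  depth-three representation) contains ALL double-difference forms and has dimension `≥ (n−1)² + 1`.

Calibration: elementary (folklore representation theory of `Sym_n × Sym_n` on `ℂ^{n×n}`: `(1 ⊕ S) ⊠ (1 ⊕ S)` is multiplicity-free);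
unconditional and VH-free; the orbit-restorability of matrix-symmetric elements of `ℂ[r, c]` with an absolute constant is the
follow-up.  Nothing here bears on VP ≠ VNP. [folklore]

## References
* A. Dawar, G. Wilsenach, *Symmetric arithmetic circuits*, ToC 21 (2025), §3.3. [DawarWilsenach2025]
-/

noncomputable section

open scoped Classical

-- `Summit.ValiantsHypothesis.ValiantsHypothesis.…` is the tree's single-conjunct layout (Sub = Summit).
set_option linter.dupNamespace false

namespace Summit.ValiantsHypothesis.ValiantsHypothesis.Theorems

namespace RowColumnDichotomy

open MvPolynomial Equiv

variable {n : ℕ}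

/-! ### First case: polynomials in row sums and column sums -/

/-- **Vanishing double differences ⇒ a combination of `1`, the row sums and the column sums.** [folklore] -/
theorem exists_eq_rowcol {w : MvPolynomial (Fin n × Fin n) ℂ} (hw : w.totalDegree ≤ 1)
    (hdd : ∀ a a' b b' : Fin n,
      coeff (Finsupp.single (a, b) 1) w - coeff (Finsupp.single (a', b) 1) w -
        coeff (Finsupp.single (a, b') 1) w + coeff (Finsupp.single (a', b') 1) w = 0) :
    ∃ (c₀ : ℂ) (α β : Fin n → ℂ), w = C c₀ + ∑ i : Fin n, C (α i) * ∑ j : Fin n, X (i, j) +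
      ∑ j : Fin n, C (β j) * ∑ i : Fin n, X (i, j) := by
  -- a general coefficient computation for the right-hand side
  have key : ∀ (c₀ : ℂ) (α β : Fin n → ℂ),
      (∀ P : Fin n × Fin n, coeff (Finsupp.single P 1)
        (C c₀ + ∑ i : Fin n, C (α i) * ∑ j : Fin n, X (i, j) + ∑ j : Fin n, C (β j) * ∑ i : Fin n, X (i, j) :
          MvPolynomial (Fin n × Fin n) ℂ) = α P.1 + β P.2) ∧
      coeff 0 (C c₀ + ∑ i : Fin n, C (α i) * ∑ j : Fin n, X (i, j) + ∑ j : Fin n, C (β j) * ∑ i : Fin n, X (i, j) :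
          MvPolynomial (Fin n × Fin n) ℂ) = c₀ ∧
      (C c₀ + ∑ i : Fin n, C (α i) * ∑ j : Fin n, X (i, j) + ∑ j : Fin n, C (β j) * ∑ i : Fin n, X (i, j) :
          MvPolynomial (Fin n × Fin n) ℂ).totalDegree ≤ 1 := by
    intro c₀ α β
    refine ⟨fun P => ?_, ?_, ?_⟩
    · rw [coeff_add, coeff_add, coeff_single_C, zero_add, coeff_sum, coeff_sum]
      simp only [coeff_C_mul, coeff_single_rowSum, coeff_single_colSum, mul_ite, mul_one, mul_zero]
      rw [Finset.sum_ite_eq Finset.univ P.1 α, Finset.sum_ite_eq Finset.univ P.2 β, if_pos (Finset.mem_univ _),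
        if_pos (Finset.mem_univ _)]
    · rw [coeff_add, coeff_add, coeff_zero_C, coeff_sum, coeff_sum]
      simp only [coeff_C_mul, coeff_sum, coeff_zero_X, Finset.sum_const_zero, mul_zero, add_zero]
    · have hrow : ∀ i : Fin n, (C (α i) * ∑ j : Fin n, X (i, j) : MvPolynomial (Fin n × Fin n) ℂ).totalDegree ≤ 1 := by
        intro i
        refine (totalDegree_mul _ _).trans ?_
        rw [totalDegree_C, zero_add]
        refine (totalDegree_finsetSum _ _).trans (Finset.sup_le fun j _ => ?_)
        rw [totalDegree_X]
      have hcol : ∀ j : Fin n, (C (β j) * ∑ i : Fin n, X (i, j) : MvPolynomial (Fin n × Fin n) ℂ).totalDegree ≤ 1 := by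
        intro j
        refine (totalDegree_mul _ _).trans ?_
        rw [totalDegree_C, zero_add]
        refine (totalDegree_finsetSum _ _).trans (Finset.sup_le fun i _ => ?_)
        rw [totalDegree_X]
      refine (totalDegree_add _ _).trans (max_le ((totalDegree_add _ _).trans (max_le ?_ ?_)) ?_)
      · rw [totalDegree_C]; exact Nat.zero_le _
      · exact (totalDegree_finsetSum _ _).trans (Finset.sup_le fun i _ => hrow i)
      · exact (totalDegree_finsetSum _ _).trans (Finset.sup_le fun j _ => hcol j)
  rcases Nat.eq_zero_or_pos n with hn | hn
  · subst hn
    refine ⟨coeff 0 w, fun _ => 0, fun _ => 0, ?_⟩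
    obtain ⟨h1, h2, h3⟩ := key (coeff 0 w) (fun _ => 0) (fun _ => 0)
    rw [← sub_eq_zero]
    refine StableForms.eq_zero_of_coeffs ((totalDegree_sub _ _).trans (max_le hw h3)) ?_ ?_
    · rw [coeff_sub, h2, sub_self]
    · intro P; exact P.1.elim0
  · set a₀ : Fin n := ⟨0, hn⟩
    refine ⟨coeff 0 w, fun i => coeff (Finsupp.single (i, a₀) 1) w - coeff (Finsupp.single (a₀, a₀) 1) w,
      fun j => coeff (Finsupp.single (a₀, j) 1) w, ?_⟩
    obtain ⟨h1, h2, h3⟩ := key (coeff 0 w)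
      (fun i => coeff (Finsupp.single (i, a₀) 1) w - coeff (Finsupp.single (a₀, a₀) 1) w)
      (fun j => coeff (Finsupp.single (a₀, j) 1) w)
    rw [← sub_eq_zero]
    refine StableForms.eq_zero_of_coeffs ((totalDegree_sub _ _).trans (max_le hw h3)) ?_ ?_
    · rw [coeff_sub, h2, sub_self]
    · rintro ⟨i, j⟩
      rw [coeff_sub, h1]
      have := hdd i a₀ j a₀
      simp only at this ⊢
      linear_combination this

/-- **In the first case `W ≤ span(1, row sums, column sums)`.** [folklore] -/
theorem le_span_rowcol {W : Submodule ℂ (MvPolynomial (Fin n × Fin n) ℂ)}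
    (hdeg : ∀ w ∈ W, MvPolynomial.totalDegree w ≤ 1)
    (hdd : ∀ w ∈ W, ∀ a a' b b' : Fin n,
      coeff (Finsupp.single (a, b) 1) w - coeff (Finsupp.single (a', b) 1) w -
        coeff (Finsupp.single (a, b') 1) w + coeff (Finsupp.single (a', b') 1) w = 0) :
    W ≤ Submodule.span ℂ (insert (C 1) (Set.range (fun i : Fin n => ∑ j : Fin n, (X (i, j) : MvPolynomial (Fin n × Fin n) ℂ)) ∪
      Set.range (fun j : Fin n => ∑ i : Fin n, (X (i, j) : MvPolynomial (Fin n × Fin n) ℂ)))) := by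
  intro w hw
  obtain ⟨c₀, α, β, hwe⟩ := exists_eq_rowcol (hdeg w hw) (hdd w hw)
  rw [hwe]
  refine Submodule.add_mem _ (Submodule.add_mem _ ?_ ?_) ?_
  · rw [show (C c₀ : MvPolynomial (Fin n × Fin n) ℂ) = c₀ • C 1 by rw [smul_eq_C_mul, C_1, mul_one]]
    exact Submodule.smul_mem _ _ (Submodule.subset_span (Set.mem_insert _ _))
  · refine Submodule.sum_mem _ fun i _ => ?_
    rw [← smul_eq_C_mul]
    exact Submodule.smul_mem _ _ (Submodule.subset_span (Set.mem_insert_of_mem _ (Or.inl ⟨i, rfl⟩)))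
  · refine Submodule.sum_mem _ fun j _ => ?_
    rw [← smul_eq_C_mul]
    exact Submodule.smul_mem _ _ (Submodule.subset_span (Set.mem_insert_of_mem _ (Or.inr ⟨j, rfl⟩)))

/-! ### Second case: the dimension is at least `(n−1)² + 1` -/

/-- **In the second case `(n−1)² + 1 ≤ dim W`** (if `W` also contains the constants): `1` and the `(n−1)²` double-difference
forms `x_ij − x_{i n} − x_{n j} + x_{n n}` (`i, j < n`, last index `n`) are linearly independent. [folklore] -/
theorem sq_succ_le_finrank {W : Submodule ℂ (MvPolynomial (Fin n × Fin n) ℂ)} [FiniteDimensional ℂ W]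
    (h1 : (C 1 : MvPolynomial (Fin n × Fin n) ℂ) ∈ W)
    (hE : ∀ a a' b b' : Fin n, a ≠ a' → b ≠ b' →
      (X (a, b) - X (a', b) - X (a, b') + X (a', b') : MvPolynomial (Fin n × Fin n) ℂ) ∈ W) :
    (n - 1) ^ 2 + 1 ≤ Module.finrank ℂ W := by
  have hC1 : (⟨C 1, h1⟩ : W) ≠ 0 := by
    rw [Ne, Submodule.mk_eq_zero, C_1]; exact one_ne_zero
  cases n with
  | zero =>
    have hli : LinearIndependent ℂ (fun _ : Unit => (⟨C 1, h1⟩ : W)) :=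
      (linearIndependent_unique_iff (v := fun _ : Unit => (⟨C 1, h1⟩ : W))).2 hC1
    have := hli.fintype_card_le_finrank
    simpa using this
  | succ m =>
    -- the family: `none ↦ 1`, `some (i, j) ↦ x_ij − x_{i,last} − x_{last,j} + x_{last,last}`
    let u : Option (Fin m × Fin m) → MvPolynomial (Fin (m + 1) × Fin (m + 1)) ℂ := fun o =>
      match o with
      | none => C 1
      | some ij => X (Fin.castSucc ij.1, Fin.castSucc ij.2) - X (Fin.last m, Fin.castSucc ij.2) -
          X (Fin.castSucc ij.1, Fin.last m) + X (Fin.last m, Fin.last m)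
    have huW : ∀ o, u o ∈ W := by
      rintro (_ | ⟨i, j⟩)
      · exact h1
      · exact hE _ _ _ _ (Fin.castSucc_lt_last i).ne (Fin.castSucc_lt_last j).ne
    -- coefficient functionals separating the family
    have hcoef_some : ∀ (i j : Fin m) (o : Option (Fin m × Fin m)),
        coeff (Finsupp.single (Fin.castSucc i, Fin.castSucc j) 1) (u o) = if o = some (i, j) then 1 else 0 := by
      intro i j o
      rcases o with _ | ⟨i', j'⟩
      · simp only [u, coeff_single_C, reduceCtorEq, if_false]
      · simp only [u, coeff_add, coeff_sub, coeff_single_X, Prod.mk.injEq, Option.some.injEq,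
          (Fin.castSucc_lt_last i).ne, (Fin.castSucc_lt_last j).ne, false_and, and_false, if_false, sub_zero,
          add_zero, Fin.castSucc_inj]
        by_cases h : i = i' ∧ j = j'
        · rw [if_pos h, if_pos (show i' = i ∧ j' = j from ⟨h.1.symm, h.2.symm⟩)]
        · rw [if_neg h, if_neg (show ¬(i' = i ∧ j' = j) from fun h' => h ⟨h'.1.symm, h'.2.symm⟩)]
    have hcoef_none : ∀ o : Option (Fin m × Fin m), coeff 0 (u o) = if o = none then 1 else 0 := by
      rintro (_ | ⟨i', j'⟩)
      · simp only [u, coeff_zero_C, if_true]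
      · simp only [u, coeff_add, coeff_sub, coeff_zero_X, sub_zero, add_zero, reduceCtorEq, if_false]
    -- linear independence in the ambient space
    have hli : LinearIndependent ℂ u := by
      rw [linearIndependent_iff']
      intro S g hsum o ho
      rcases o with _ | ⟨i, j⟩
      · have h := congrArg (coeff (0 : Fin (m + 1) × Fin (m + 1) →₀ ℕ)) hsum
        rw [coeff_sum, coeff_zero, Finset.sum_eq_single none] at h
        · simpa [coeff_smul, hcoef_none] using h
        · intro o _ ho'
          rw [coeff_smul, hcoef_none, if_neg ho', smul_zero]
        · intro h'; exact absurd ho h'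
      · have h := congrArg (coeff (Finsupp.single (Fin.castSucc i, Fin.castSucc j) 1)) hsum
        rw [coeff_sum, coeff_zero, Finset.sum_eq_single (some (i, j))] at h
        · simpa [coeff_smul, hcoef_some] using h
        · intro o _ ho'
          rw [coeff_smul, hcoef_some, if_neg ho', smul_zero]
        · intro h'; exact absurd ho h'
    have hli' : LinearIndependent ℂ (fun o => (⟨u o, huW o⟩ : W)) :=
      LinearIndependent.of_comp W.subtype (by exact hli)
    have := hli'.fintype_card_le_finrank
    simp only [Fintype.card_option, Fintype.card_prod, Fintype.card_fin] at this
    simpa [sq] using this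

/-! ### The essential-variable dichotomy for matrix-symmetric polynomials -/

/-- **ESSENTIAL-VARIABLE DICHOTOMY.**  A matrix-symmetric polynomial on the `n × n` matrix which lies in the subalgebra generated
by a space `Λ` of affine forms containing the constants with `dim Λ ≤ (n−1)²` is a polynomial in the row sums `Σ_j x_ij` and the
column sums `Σ_i x_ij`. [folklore] -/
theorem mem_adjoin_rowcol_of_admissible {p : MvPolynomial (Fin n × Fin n) ℂ}
    (hsym : ∀ σ τ : Perm (Fin n), rename (fun q : Fin n × Fin n => (σ q.1, τ q.2)) p = p)
    {Λ : Submodule ℂ (MvPolynomial (Fin n × Fin n) ℂ)} [FiniteDimensional ℂ Λ]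
    (hΛ : LinearSubalgebra.Admissible p Λ) (hdim : Module.finrank ℂ Λ ≤ (n - 1) ^ 2) :
    p ∈ Algebra.adjoin ℂ (Set.range (fun i : Fin n => ∑ j : Fin n, (X (i, j) : MvPolynomial (Fin n × Fin n) ℂ)) ∪
      Set.range (fun j : Fin n => ∑ i : Fin n, (X (i, j) : MvPolynomial (Fin n × Fin n) ℂ))) := by
  set W := LinearSubalgebra.ess p with hWdef
  have hadm : LinearSubalgebra.Admissible p W := LinearSubalgebra.admissible_ess p
  have hWle : W ≤ Λ := LinearSubalgebra.ess_le hΛ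
  haveI : FiniteDimensional ℂ W := Submodule.finiteDimensional_of_le hWle
  have hdimW : Module.finrank ℂ W ≤ (n - 1) ^ 2 := (Submodule.finrank_mono hWle).trans hdim
  have hdeg : ∀ w ∈ W, MvPolynomial.totalDegree w ≤ 1 := fun w hw => LinearSubalgebra.mem_deg1.1 (hadm.1 hw)
  -- the essential space of a matrix-symmetric polynomial is stable
  have hstab : ∀ (σ τ : Perm (Fin n)) (w : MvPolynomial (Fin n × Fin n) ℂ), w ∈ W →
      rename (fun q : Fin n × Fin n => (σ q.1, τ q.2)) w ∈ W := by
    intro σ τ w hw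
    set φ : MvPolynomial (Fin n × Fin n) ℂ ≃ₐ[ℂ] MvPolynomial (Fin n × Fin n) ℂ :=
      renameEquiv ℂ (Equiv.prodCongr σ τ) with hφdef
    have hφfun : ∀ q : MvPolynomial (Fin n × Fin n) ℂ, φ q = rename (fun x : Fin n × Fin n => (σ x.1, τ x.2)) q := by
      intro q
      show rename _ q = rename _ q
      rfl
    have hφ : ∀ q : MvPolynomial (Fin n × Fin n) ℂ, q.totalDegree ≤ 1 → (φ q).totalDegree ≤ 1 := fun q hq =>
      (hφfun q).symm ▸ (totalDegree_rename_le _ _).trans hq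
    have hφ' : ∀ q : MvPolynomial (Fin n × Fin n) ℂ, q.totalDegree ≤ 1 → (φ.symm q).totalDegree ≤ 1 := fun q hq => by
      rw [hφdef, renameEquiv_symm]
      exact (totalDegree_rename_le _ _).trans hq
    have hess := LinearSubalgebra.ess_map φ hφ hφ' p
    have hφp : φ p = p := by rw [hφfun]; exact hsym σ τ
    rw [hφp] at hess
    have : φ w ∈ LinearSubalgebra.ess p := by
      rw [hess]; exact ⟨w, hw, rfl⟩
    rwa [hφfun] at this
  rcases dichotomy W hdeg hstab with hdd | hEE
  · have hle := le_span_rowcol hdeg hdd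
    have hp : p ∈ Algebra.adjoin ℂ (W : Set (MvPolynomial (Fin n × Fin n) ℂ)) := hadm.2.2
    refine (Algebra.adjoin_le ?_ : Algebra.adjoin ℂ (W : Set (MvPolynomial (Fin n × Fin n) ℂ)) ≤ _) hp
    intro w hw
    have hw' := hle hw
    have hsub : (insert (C 1) (Set.range (fun i : Fin n => ∑ j : Fin n, (X (i, j) : MvPolynomial (Fin n × Fin n) ℂ)) ∪
        Set.range (fun j : Fin n => ∑ i : Fin n, (X (i, j) : MvPolynomial (Fin n × Fin n) ℂ))) : Set _) ⊆
        (Subalgebra.toSubmodule (Algebra.adjoin ℂ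
          (Set.range (fun i : Fin n => ∑ j : Fin n, (X (i, j) : MvPolynomial (Fin n × Fin n) ℂ)) ∪
            Set.range (fun j : Fin n => ∑ i : Fin n, (X (i, j) : MvPolynomial (Fin n × Fin n) ℂ)))) :
          Submodule ℂ (MvPolynomial (Fin n × Fin n) ℂ)) := by
      intro x hx
      rcases (Set.mem_insert_iff.1 hx) with rfl | hx
      · rw [C_1]; exact Subalgebra.one_mem _
      · exact Algebra.subset_adjoin hx
    exact (Subalgebra.mem_toSubmodule _).1 ((Submodule.span_le.2 hsub) hw')
  · have := sq_succ_le_finrank hadm.2.1 hEE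
    omega

/-- **THE SUB-QUADRATIC DEPTH-THREE STRATUM.**  A matrix-symmetric polynomial with a depth-three representation
`p = Σ_{i<k} C(a i) · Π (L i)` (every factor of total degree `≤ 1`) of total product fan-in `Σ_i |L i| < (n−1)²` is a polynomial in
the row sums and the column sums. [folklore] -/
theorem mem_adjoin_rowcol_of_depthThree {p : MvPolynomial (Fin n × Fin n) ℂ}
    (hsym : ∀ σ τ : Perm (Fin n), rename (fun q : Fin n × Fin n => (σ q.1, τ q.2)) p = p)
    {k : ℕ} (a : Fin k → ℂ) (L : Fin k → Multiset (MvPolynomial (Fin n × Fin n) ℂ))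
    (hL : ∀ i, ∀ ℓ ∈ L i, ℓ.totalDegree ≤ 1) (hp : p = ∑ i, C (a i) * (L i).prod)
    (hfan : ∑ i, Multiset.card (L i) < (n - 1) ^ 2) :
    p ∈ Algebra.adjoin ℂ (Set.range (fun i : Fin n => ∑ j : Fin n, (X (i, j) : MvPolynomial (Fin n × Fin n) ℂ)) ∪
      Set.range (fun j : Fin n => ∑ i : Fin n, (X (i, j) : MvPolynomial (Fin n × Fin n) ℂ))) := by
  -- the span of `1` and all factors
  set S : Finset (MvPolynomial (Fin n × Fin n) ℂ) := insert (C 1) (Finset.univ.biUnion fun i => (L i).toFinset) with hS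
  set Λ : Submodule ℂ (MvPolynomial (Fin n × Fin n) ℂ) := Submodule.span ℂ (S : Set (MvPolynomial (Fin n × Fin n) ℂ))
    with hΛ
  haveI : FiniteDimensional ℂ Λ := FiniteDimensional.span_finset ℂ S
  have hcard : S.card ≤ (n - 1) ^ 2 := by
    refine (Finset.card_insert_le _ _).trans ?_
    have h1 : (Finset.univ.biUnion fun i => (L i).toFinset).card ≤ ∑ i, Multiset.card (L i) :=
      Finset.card_biUnion_le.trans (Finset.sum_le_sum fun i _ => Multiset.toFinset_card_le _)
    omega
  have hdim : Module.finrank ℂ Λ ≤ (n - 1) ^ 2 := (finrank_span_finset_le_card S).trans hcard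
  have hadm : LinearSubalgebra.Admissible p Λ := by
    refine ⟨?_, Submodule.subset_span (by simp [hS]), ?_⟩
    · rw [hΛ, Submodule.span_le]
      intro x hx
      rw [hS, Finset.coe_insert, Set.mem_insert_iff] at hx
      rcases hx with rfl | hx
      · exact LinearSubalgebra.mem_deg1.2 (by rw [totalDegree_C]; exact Nat.zero_le _)
      · rw [Finset.mem_coe, Finset.mem_biUnion] at hx
        obtain ⟨i, -, hi⟩ := hx
        exact LinearSubalgebra.mem_deg1.2 (hL i x (Multiset.mem_toFinset.1 hi))
    · rw [hp]
      refine Subalgebra.sum_mem _ fun i _ => Subalgebra.mul_mem _ (Subalgebra.algebraMap_mem _ _) ?_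
      refine Subalgebra.multiset_prod_mem _ fun ℓ hℓ => Algebra.subset_adjoin ?_
      refine Submodule.subset_span ?_
      rw [hS, Finset.coe_insert]
      refine Set.mem_insert_of_mem _ ?_
      rw [Finset.mem_coe, Finset.mem_biUnion]
      exact ⟨i, Finset.mem_univ _, Multiset.mem_toFinset.2 hℓ⟩
  exact mem_adjoin_rowcol_of_admissible hsym hadm hdim

/-! ### Rigidity above the threshold: every admissible space contains all double-difference forms -/

/-- **The essential space of a matrix-symmetric polynomial is stable** under `x_pq ↦ x_{σ p, τ q}`. [folklore] -/
theorem rename₂_mem_ess {p : MvPolynomial (Fin n × Fin n) ℂ}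
    (hsym : ∀ σ τ : Perm (Fin n), rename (fun q : Fin n × Fin n => (σ q.1, τ q.2)) p = p)
    (σ τ : Perm (Fin n)) {w : MvPolynomial (Fin n × Fin n) ℂ} (hw : w ∈ LinearSubalgebra.ess p) :
    rename (fun q : Fin n × Fin n => (σ q.1, τ q.2)) w ∈ LinearSubalgebra.ess p := by
  set φ : MvPolynomial (Fin n × Fin n) ℂ ≃ₐ[ℂ] MvPolynomial (Fin n × Fin n) ℂ :=
    renameEquiv ℂ (Equiv.prodCongr σ τ) with hφdef
  have hφfun : ∀ q : MvPolynomial (Fin n × Fin n) ℂ, φ q = rename (fun x : Fin n × Fin n => (σ x.1, τ x.2)) q := by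
    intro q
    show rename _ q = rename _ q
    rfl
  have hφ : ∀ q : MvPolynomial (Fin n × Fin n) ℂ, q.totalDegree ≤ 1 → (φ q).totalDegree ≤ 1 := fun q hq =>
    (hφfun q).symm ▸ (totalDegree_rename_le _ _).trans hq
  have hφ' : ∀ q : MvPolynomial (Fin n × Fin n) ℂ, q.totalDegree ≤ 1 → (φ.symm q).totalDegree ≤ 1 := fun q hq => by
    rw [hφdef, renameEquiv_symm]
    exact (totalDegree_rename_le _ _).trans hq
  have hess := LinearSubalgebra.ess_map φ hφ hφ' p
  have hφp : φ p = p := by rw [hφfun]; exact hsym σ τ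
  rw [hφp] at hess
  have : φ w ∈ LinearSubalgebra.ess p := by
    rw [hess]; exact ⟨w, hw, rfl⟩
  rwa [hφfun] at this

/-- **RIGIDITY ABOVE THE THRESHOLD.**  If a matrix-symmetric `p` is NOT a polynomial in the row sums and the column sums, then EVERY
space `Λ` of affine forms containing the constants with `p ∈ ℂ[Λ]` — in particular the span of `1` and the factors of ANY depth-three
representation of `p` — contains every double-difference form `x_ab − x_a'b − x_ab' + x_a'b'` (`a ≠ a'`, `b ≠ b'`). [folklore] -/
theorem ddiff_mem_of_not_mem_adjoin_rowcol {p : MvPolynomial (Fin n × Fin n) ℂ}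
    (hsym : ∀ σ τ : Perm (Fin n), rename (fun q : Fin n × Fin n => (σ q.1, τ q.2)) p = p)
    (hnot : p ∉ Algebra.adjoin ℂ (Set.range (fun i : Fin n => ∑ j : Fin n, (X (i, j) : MvPolynomial (Fin n × Fin n) ℂ)) ∪
      Set.range (fun j : Fin n => ∑ i : Fin n, (X (i, j) : MvPolynomial (Fin n × Fin n) ℂ))))
    {Λ : Submodule ℂ (MvPolynomial (Fin n × Fin n) ℂ)} (hΛ : LinearSubalgebra.Admissible p Λ)
    {a a' b b' : Fin n} (ha : a ≠ a') (hb : b ≠ b') :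
    (X (a, b) - X (a', b) - X (a, b') + X (a', b') : MvPolynomial (Fin n × Fin n) ℂ) ∈ Λ := by
  set W := LinearSubalgebra.ess p with hWdef
  have hadm : LinearSubalgebra.Admissible p W := LinearSubalgebra.admissible_ess p
  have hdeg : ∀ w ∈ W, MvPolynomial.totalDegree w ≤ 1 := fun w hw => LinearSubalgebra.mem_deg1.1 (hadm.1 hw)
  have hstab : ∀ (σ τ : Perm (Fin n)) (w : MvPolynomial (Fin n × Fin n) ℂ), w ∈ W →
      rename (fun q : Fin n × Fin n => (σ q.1, τ q.2)) w ∈ W := fun σ τ _ hw => rename₂_mem_ess hsym σ τ hw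
  rcases dichotomy W hdeg hstab with hdd | hEE
  · exfalso
    refine hnot ?_
    have hle := le_span_rowcol hdeg hdd
    have hp : p ∈ Algebra.adjoin ℂ (W : Set (MvPolynomial (Fin n × Fin n) ℂ)) := hadm.2.2
    refine (Algebra.adjoin_le ?_ : Algebra.adjoin ℂ (W : Set (MvPolynomial (Fin n × Fin n) ℂ)) ≤ _) hp
    intro w hw
    have hw' := hle hw
    have hsub : (insert (C 1) (Set.range (fun i : Fin n => ∑ j : Fin n, (X (i, j) : MvPolynomial (Fin n × Fin n) ℂ)) ∪
        Set.range (fun j : Fin n => ∑ i : Fin n, (X (i, j) : MvPolynomial (Fin n × Fin n) ℂ))) : Set _) ⊆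
        (Subalgebra.toSubmodule (Algebra.adjoin ℂ
          (Set.range (fun i : Fin n => ∑ j : Fin n, (X (i, j) : MvPolynomial (Fin n × Fin n) ℂ)) ∪
            Set.range (fun j : Fin n => ∑ i : Fin n, (X (i, j) : MvPolynomial (Fin n × Fin n) ℂ)))) :
          Submodule ℂ (MvPolynomial (Fin n × Fin n) ℂ)) := by
      intro x hx
      rcases (Set.mem_insert_iff.1 hx) with rfl | hx
      · rw [C_1]; exact Subalgebra.one_mem _
      · exact Algebra.subset_adjoin hx
    exact (Subalgebra.mem_toSubmodule _).1 ((Submodule.span_le.2 hsub) hw')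
  · exact LinearSubalgebra.ess_le hΛ (hEE a a' b b' ha hb)

/-- **Hence, above the threshold, every admissible space has dimension `≥ (n−1)² + 1`**: a matrix-symmetric polynomial outside
`ℂ[r, c]` has at least `(n−1)² + 1` essential variables, and every depth-three representation of it uses factors spanning all the
double-difference forms. [folklore] -/
theorem sq_succ_le_finrank_of_not_mem_adjoin_rowcol {p : MvPolynomial (Fin n × Fin n) ℂ}
    (hsym : ∀ σ τ : Perm (Fin n), rename (fun q : Fin n × Fin n => (σ q.1, τ q.2)) p = p)
    (hnot : p ∉ Algebra.adjoin ℂ (Set.range (fun i : Fin n => ∑ j : Fin n, (X (i, j) : MvPolynomial (Fin n × Fin n) ℂ)) ∪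
      Set.range (fun j : Fin n => ∑ i : Fin n, (X (i, j) : MvPolynomial (Fin n × Fin n) ℂ))))
    {Λ : Submodule ℂ (MvPolynomial (Fin n × Fin n) ℂ)} [FiniteDimensional ℂ Λ] (hΛ : LinearSubalgebra.Admissible p Λ) :
    (n - 1) ^ 2 + 1 ≤ Module.finrank ℂ Λ :=
  sq_succ_le_finrank hΛ.2.1 fun _ _ _ _ ha hb => ddiff_mem_of_not_mem_adjoin_rowcol hsym hnot hΛ ha hb

end RowColumnDichotomy

end Summit.ValiantsHypothesis.ValiantsHypothesis.Theorems

end
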